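import Summits.CriticalPhenomena.CardyFormulaZ2.Theorems.CardyBoundaryCoulombGasRectilinearCardyStubEventIdentityPart11
import Summits.CriticalPhenomena.CardyFormulaZ2.Theorems.CardyBoundaryCoulombGasRectilinearCardyStubEventIdentityPart12

/-!
# Stub `stub_eventIdentity` of line `excursion-kernel-covariance` (crux `RectilinearCardy`,
# stmt-CriticalPhenomena-5660) — Part 13: the registered stub (assembly)

**Theorem `stub_eventIdentity`** (registered stub I of the line skeleton
`Lines/excursion_kernel_covariance.lean`, verbatim): for an injective admissible placement `p` of
the `(1,3,1,1; 1)` leg insertion on a regular collar domain `V` and every `ω ⊆ E`, the configuration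
is RAINBOW iff the jump vertex `X′ = (dsucc d₀).1` is joined by `ω` to the level `-1` wired arc and
the level `-3` wired arc is not joined to it.

Assembly of Parts 6–12: the sources sit at cycle indices `2 ≤ iA < iB < iC` (Part 6), the wired sets
of the walk are the vertex blocks `W₁ = [iA, iB]`, `W₂ = {X} ∪ [iC, period)` (Part 6), `Rainbow` is
the pairing `e_v'' → e_A`, `e_B → e_v'`, `e_X → e_C` of the six strand ends (Part 7), the pairing
gives the hull event (Part 12) and the hull event gives the pairing (Part 11). The flatness radius
`sinkLegs + 4` of the signature exceeds the radius `sinkLegs + 3` used throughout; the lattice /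
king connectivity and king-chart hypotheses are not needed.
-/

namespace Summit.CriticalPhenomena.CardyFormulaZ2.Cruxes.RectilinearCardy.ExcursionKernelCovariance

open Finset Literature.Probability.LatticeModels Literature.Probability.LatticeModels.CollarLegModel
open Summit.CriticalPhenomena.CardyFormulaZ2.Cruxes.BoundaryDefectGaussianR.RainbowMonomialsInExcursionKernels

/-- **The event identity at the level of the jump collar** (all hypotheses explicit; landing
anchor): for admissible `(1,1,1; 3)` data with sources at cycle indices `2 ≤ iA < iB < iC`, flat
insertion points and charted boundary, and `ω ⊆ E`: `Rainbow ι V ω` iff the jump vertex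
`(e 1).1` is `ω`-joined to the block `W₁ = [iA, iB]` and no vertex of `W₂ = {X} ∪ [iC, period)`
is `ω`-joined to `W₁`. [cite: BaxterKellandWu1976, §3–§4] -/
theorem ei_rainbow_iff_hull {ι : LegInsertionData} {V : Finset (ℤ × ℤ)} {d₀ : Dart} {iA iB iC : ℕ}
    (hadm : ι.IsAdmissible V)
    (hflat : ∀ x ∈ insert ι.sink ι.source, ∃ dvec : ℤ × ℤ,
      (dvec = (1, 0) ∨ dvec = (-1, 0) ∨ dvec = (0, 1) ∨ dvec = (0, -1)) ∧
      ∀ v : ℤ × ℤ, (v.1 - x.1) ^ 2 + (v.2 - x.2) ^ 2 ≤ ((ι.sinkLegs : ℤ) + 3) ^ 2 →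
        (v ∈ V ↔ 0 ≤ (v.1 - x.1) * dvec.1 + (v.2 - x.2) * dvec.2))
    (hchart : ∀ u ∈ V, ∀ k : Fin 4, u + dir k ∉ V → ∃ (K : Fin 4) (c₁ c₂ : ℤ),
      (∀ v : ℤ × ℤ, |v.1 - u.1| ≤ 3 → |v.2 - u.2| ≤ 3 →
        (v ∈ V ↔ c₂ ≤ v.1 * (dir (K + 1)).1 + v.2 * (dir (K + 1)).2)) ∨
      (∀ v : ℤ × ℤ, |v.1 - u.1| ≤ 3 → |v.2 - u.2| ≤ 3 →
        (v ∈ V ↔ c₁ ≤ v.1 * (dir K).1 + v.2 * (dir K).2 ∧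
          c₂ ≤ v.1 * (dir (K + 1)).1 + v.2 * (dir (K + 1)).2)) ∨
      (∀ v : ℤ × ℤ, |v.1 - u.1| ≤ 3 → |v.2 - u.2| ≤ 3 →
        (v ∈ V ↔ c₂ ≤ v.1 * (dir (K + 1)).1 + v.2 * (dir (K + 1)).2 ∨
          v.1 * (dir K).1 + v.2 * (dir K).2 ≤ c₁)))
    (hv₀ : d₀.1 ∈ V) (ht₀ : dartTip d₀ ∉ V) (hout : outDart V d₀.1 = some d₀)
  (h2 : 2 ≤ iA) (hAB : iA < iB) (hBC : iB < iC) (hCP : iC < period V d₀)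
  (hcA : ((neighbours ((dsucc V)^[iA] d₀).1).filter (fun y ↦ y ∉ V)).card = 1)
  (hcB : ((neighbours ((dsucc V)^[iB] d₀).1).filter (fun y ↦ y ∉ V)).card = 1)
  (hcC : ((neighbours ((dsucc V)^[iC] d₀).1).filter (fun y ↦ y ∉ V)).card = 1)
  (hsrc : ι.source = {((dsucc V)^[iA] d₀).1, ((dsucc V)^[iB] d₀).1, ((dsucc V)^[iC] d₀).1})
  (hlegs : ∀ x ∈ ι.source, ι.legs x = 1) (hsink : ι.sink = d₀.1) (hsl : ι.sinkLegs = 3) {ω : Finset ((ℤ × ℤ) × Bool)} (hω : ω ⊆ (ι.model V).E) :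
    ι.Rainbow V ω ↔
      (∃ x, (∃ s, iA ≤ s ∧ s ≤ iB ∧ ((dsucc V)^[s] d₀).1 = x) ∧ Relation.ReflTransGen (fun b c : ℤ × ℤ ↦ ∃ e ∈ ω, (e.1 = b ∧ SixVertex.edgeTip e = c) ∨ (e.1 = c ∧ SixVertex.edgeTip e = b)) ((dsucc V)^[1] d₀).1 x) ∧
        ¬∃ y, (y = d₀.1 ∨ ∃ s, iC ≤ s ∧ s < period V d₀ ∧ ((dsucc V)^[s] d₀).1 = y) ∧ ∃ x, (∃ s, iA ≤ s ∧ s ≤ iB ∧ ((dsucc V)^[s] d₀).1 = x) ∧ Relation.ReflTransGen (fun b c : ℤ × ℤ ↦ ∃ e ∈ ω, (e.1 = b ∧ SixVertex.edgeTip e = c) ∨ (e.1 = c ∧ SixVertex.edgeTip e = b)) y x := by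
  rw [ei_rainbow_iff hadm hflat hv₀ ht₀ hout h2 hAB hBC hCP hcA hcB hcC hsrc hlegs hsink hsl ω]
  constructor
  · rintro ⟨hJA, hJB, hJX⟩
    exact ⟨ei_joined_W1_of_pairing hadm hflat hchart hv₀ ht₀ hout h2 hAB hBC hCP hcA hcB hcC hsrc hlegs hsink hsl hω hJA hJB hJX,
      ei_sep_of_pairing hadm hflat hchart hv₀ ht₀ hout h2 hAB hBC hCP hcA hcB hcC hsrc hlegs hsink hsl hω hJA hJB hJX⟩
  · rintro ⟨H1, H2⟩
    exact ei_pairing_of_hull hadm hflat hchart hv₀ ht₀ hout h2 hAB hBC hCP hcA hcB hcC hsrc hlegs hsink hsl hω H1 H2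

/-- **Stub I — the EVENT IDENTITY of the `(1,3,1,1; 1)` insertion** (registered stub of line
`excursion-kernel-covariance`, crux `RectilinearCardy`): for an injective admissible placement `p`
(sources `p 0, p 2, p 3`, sink `p 1`) on a regular collar domain `V` and every set `ω ⊆ E` of live
edges, `ω` is RAINBOW iff the jump vertex `(dsucc d₀).1` is joined by `ω` to the level `-1` wired arc
and the level `-3` wired arc is not. [cite: BaxterKellandWu1976, §3–§4] -/
theorem stub_eventIdentity :
    ∀ (V : Finset (ℤ × ℤ)) (p : Fin 4 → ℤ × ℤ), Function.Injective p →
      Literature.Probability.LatticeModels.CollarLegModel.LegInsertionData.IsAdmissible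
        (⟨(Finset.univ.erase 1).image p, fun x ↦ ∑ i ∈ (Finset.univ.erase 1).filter (fun i ↦ p i = x),
          (![1, 3, 1, 1] : Fin 4 → ℕ) i, p 1⟩ : Literature.Probability.LatticeModels.CollarLegModel.LegInsertionData) V →
      (∀ x ∈ insert (⟨(Finset.univ.erase 1).image p, fun x ↦ ∑ i ∈ (Finset.univ.erase 1).filter (fun i ↦ p i = x),
          (![1, 3, 1, 1] : Fin 4 → ℕ) i, p 1⟩ : Literature.Probability.LatticeModels.CollarLegModel.LegInsertionData).sink
          (⟨(Finset.univ.erase 1).image p, fun x ↦ ∑ i ∈ (Finset.univ.erase 1).filter (fun i ↦ p i = x),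
          (![1, 3, 1, 1] : Fin 4 → ℕ) i, p 1⟩ : Literature.Probability.LatticeModels.CollarLegModel.LegInsertionData).source,
        ∃ dvec : ℤ × ℤ, (dvec = (1, 0) ∨ dvec = (-1, 0) ∨ dvec = (0, 1) ∨ dvec = (0, -1)) ∧
          ∀ v : ℤ × ℤ, (v.1 - x.1) ^ 2 + (v.2 - x.2) ^ 2 ≤
              (((⟨(Finset.univ.erase 1).image p, fun x ↦ ∑ i ∈ (Finset.univ.erase 1).filter (fun i ↦ p i = x),
                (![1, 3, 1, 1] : Fin 4 → ℕ) i, p 1⟩ : Literature.Probability.LatticeModels.CollarLegModel.LegInsertionData).sinkLegs : ℤ) + 4) ^ 2 →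
            (v ∈ V ↔ 0 ≤ (v.1 - x.1) * dvec.1 + (v.2 - x.2) * dvec.2)) →
      (∀ u ∈ V, ∀ k : Fin 4, u + Literature.Probability.LatticeModels.CollarLegModel.dir k ∉ V → ∃ (K : Fin 4) (c₁ c₂ : ℤ), (∀ v : ℤ × ℤ, |v.1 - u.1| ≤ 3 → |v.2 - u.2| ≤ 3 → (v ∈ V ↔ c₂ ≤ v.1 * (Literature.Probability.LatticeModels.CollarLegModel.dir (K + 1)).1 + v.2 * (Literature.Probability.LatticeModels.CollarLegModel.dir (K + 1)).2)) ∨ (∀ v : ℤ × ℤ, |v.1 - u.1| ≤ 3 → |v.2 - u.2| ≤ 3 → (v ∈ V ↔ c₁ ≤ v.1 * (Literature.Probability.LatticeModels.CollarLegModel.dir K).1 + v.2 * (Literature.Probability.LatticeModels.CollarLegModel.dir K).2 ∧ c₂ ≤ v.1 * (Literature.Probability.LatticeModels.CollarLegModel.dir (K + 1)).1 + v.2 * (Literature.Probability.LatticeModels.CollarLegModel.dir (K + 1)).2)) ∨ (∀ v : ℤ × ℤ, |v.1 - u.1| ≤ 3 → |v.2 - u.2| ≤ 3 → (v ∈ V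 ↔ c₂ ≤ v.1 * (Literature.Probability.LatticeModels.CollarLegModel.dir (K + 1)).1 + v.2 * (Literature.Probability.LatticeModels.CollarLegModel.dir (K + 1)).2 ∨ v.1 * (Literature.Probability.LatticeModels.CollarLegModel.dir K).1 + v.2 * (Literature.Probability.LatticeModels.CollarLegModel.dir K).2 ≤ c₁))) →
      (∀ u ∈ V, ∀ w ∈ V, Relation.ReflTransGen (fun b c : ℤ × ℤ ↦ b ∈ V ∧ c ∈ V ∧ (b.1 - c.1) ^ 2 + (b.2 - c.2) ^ 2 = 1) u w) →
      (∀ u ∉ V, ∀ w ∉ V, Relation.ReflTransGen (fun b c : ℤ × ℤ ↦ b ∉ V ∧ c ∉ V ∧ max |b.1 - c.1| |b.2 - c.2| ≤ 1) u w) →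
      (∀ z : ℤ × ℤ, z ∉ V → (∃ v ∈ V, max |v.1 - z.1| |v.2 - z.2| ≤ 1) → ∃ σ τ a c : ℤ, |σ| ≤ 1 ∧ |τ| ≤ 1 ∧ ((∀ v : ℤ × ℤ, max |v.1 - z.1| |v.2 - z.2| ≤ 6 → (v ∈ V ↔ 0 ≤ σ * (v.1 - a) ∧ 0 ≤ τ * (v.2 - c))) ∨ (∀ v : ℤ × ℤ, max |v.1 - z.1| |v.2 - z.2| ≤ 6 → (v ∈ V ↔ 0 < σ * (v.1 - a) ∨ 0 < τ * (v.2 - c))))) →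
      ∀ d₀ : Literature.Probability.LatticeModels.CollarLegModel.Dart,
        Literature.Probability.LatticeModels.CollarLegModel.outDart V (p 1) = some d₀ →
      ∀ ω : Finset ((ℤ × ℤ) × Bool), ω ⊆ Literature.Probability.LatticeModels.CollarLegModel.inducedEdges V →
        (Literature.Probability.LatticeModels.CollarLegModel.LegInsertionData.Rainbow
            (⟨(Finset.univ.erase 1).image p, fun x ↦ ∑ i ∈ (Finset.univ.erase 1).filter (fun i ↦ p i = x),
              (![1, 3, 1, 1] : Fin 4 → ℕ) i, p 1⟩ : Literature.Probability.LatticeModels.CollarLegModel.LegInsertionData) V ω ↔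
          ((∃ x : ℤ × ℤ,
              (∃ t ∈ (⟨(Finset.univ.erase 1).image p, fun x ↦ ∑ i ∈ (Finset.univ.erase 1).filter (fun i ↦ p i = x),
                  (![1, 3, 1, 1] : Fin 4 → ℕ) i, p 1⟩ : Literature.Probability.LatticeModels.CollarLegModel.LegInsertionData).walk V,
                t.1.1 = x ∧ ((t.2.1.wired = true ∧ t.2.1.level = -1) ∨ (t.2.2.wired = true ∧ t.2.2.level = -1))) ∧
              Relation.ReflTransGen (fun b c : ℤ × ℤ ↦ ∃ e ∈ ω,
                (e.1 = b ∧ Literature.Probability.LatticeModels.SixVertex.edgeTip e = c) ∨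
                  (e.1 = c ∧ Literature.Probability.LatticeModels.SixVertex.edgeTip e = b))
                (Literature.Probability.LatticeModels.CollarLegModel.dsucc V d₀).1 x) ∧
            ¬ (∃ y : ℤ × ℤ,
                (∃ t ∈ (⟨(Finset.univ.erase 1).image p, fun x ↦ ∑ i ∈ (Finset.univ.erase 1).filter (fun i ↦ p i = x),
                    (![1, 3, 1, 1] : Fin 4 → ℕ) i, p 1⟩ : Literature.Probability.LatticeModels.CollarLegModel.LegInsertionData).walk V,
                  t.1.1 = y ∧ ((t.2.1.wired = true ∧ t.2.1.level = -3) ∨ (t.2.2.wired = true ∧ t.2.2.level = -3))) ∧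
                ∃ x : ℤ × ℤ,
                  (∃ t ∈ (⟨(Finset.univ.erase 1).image p, fun x ↦ ∑ i ∈ (Finset.univ.erase 1).filter (fun i ↦ p i = x),
                      (![1, 3, 1, 1] : Fin 4 → ℕ) i, p 1⟩ : Literature.Probability.LatticeModels.CollarLegModel.LegInsertionData).walk V,
                    t.1.1 = x ∧ ((t.2.1.wired = true ∧ t.2.1.level = -1) ∨ (t.2.2.wired = true ∧ t.2.2.level = -1))) ∧
                  Relation.ReflTransGen (fun b c : ℤ × ℤ ↦ ∃ e ∈ ω,
                    (e.1 = b ∧ Literature.Probability.LatticeModels.SixVertex.edgeTip e = c) ∨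
                      (e.1 = c ∧ Literature.Probability.LatticeModels.SixVertex.edgeTip e = b)) y x))) := by
  intro V p hinj hadm hflat7 hchart _ _ _ d₀ hd₀ ω hω
  set ι : LegInsertionData := ⟨(Finset.univ.erase 1).image p,
    fun x ↦ ∑ i ∈ (Finset.univ.erase 1).filter (fun i ↦ p i = x), (![1, 3, 1, 1] : Fin 4 → ℕ) i, p 1⟩ with hι
  have hsrc : ι.source = (Finset.univ.erase 1).image p := rfl
  have hsink : ι.sink = p 1 := rfl
  have hsl : ι.sinkLegs = 3 := sm_sinkLegs p
  have hlegs : ∀ x ∈ ι.source, ι.legs x = 1 := by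
    intro x hx
    rw [hsrc, Finset.mem_image] at hx
    obtain ⟨i, hi, rfl⟩ := hx
    exact sm_legs p hinj i (Finset.mem_erase.1 hi).1
  have h0 : outDart V ι.sink = some d₀ := hd₀
  obtain ⟨hX, hv₀, ht₀, -, iA, iB, iC, h2, hAB, hBC, hCP, hsrcE, hcards⟩ :=
    ei_indices hinj hadm hsrc hsink hsl h0
  have hout : outDart V d₀.1 = some d₀ := by rw [hX]; exact hd₀
  have hsink' : ι.sink = d₀.1 := by rw [hX]
  have hcA := (hcards iA (Or.inl rfl)).1
  have hcB := (hcards iB (Or.inr (Or.inl rfl))).1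
  have hcC := (hcards iC (Or.inr (Or.inr rfl))).1
  have hflat : ∀ x ∈ insert ι.sink ι.source, ∃ dvec : ℤ × ℤ,
      (dvec = (1, 0) ∨ dvec = (-1, 0) ∨ dvec = (0, 1) ∨ dvec = (0, -1)) ∧
      ∀ v : ℤ × ℤ, (v.1 - x.1) ^ 2 + (v.2 - x.2) ^ 2 ≤ ((ι.sinkLegs : ℤ) + 3) ^ 2 →
        (v ∈ V ↔ 0 ≤ (v.1 - x.1) * dvec.1 + (v.2 - x.2) * dvec.2) := by
    intro x hx
    obtain ⟨dvec, hd, hf⟩ := hflat7 x hx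
    refine ⟨dvec, hd, fun v hv => hf v (hv.trans ?_)⟩
    rw [hsl]; norm_num
  have hω' : ω ⊆ (ι.model V).E := hω
  have hW1 := ei_inWired1_iff hv₀ ht₀ hout h2 hAB hBC hCP hcA hcB hcC hsrcE hlegs hsink' hsl
  have hW3 := ei_inWired3_iff hv₀ ht₀ hout h2 hAB hBC hCP hcA hcB hcC hsrcE hlegs hsink' hsl
  simp only [hW1, hW3]
  exact ei_rainbow_iff_hull hadm hflat hchart hv₀ ht₀ hout h2 hAB hBC hCP hcA hcB hcC hsrcE hlegs
    hsink' hsl hω'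

end Summit.CriticalPhenomena.CardyFormulaZ2.Cruxes.RectilinearCardy.ExcursionKernelCovariance
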